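/-
Copyright (c) 2026 the pub-hodgecm-mathlib formalisation cell (harness21).  Prover seat hodgecm-mathlib-F0P3a-p02 (g19): LH3 «Transf» road,
generic jet kit for (GLUE-X-dress)∕(M2) (dealer LH3-plan (g3) board #1 deal (v) 2026-09-02; consumer F0P3a-p09 (g5)).
-/
import Mathlib.Analysis.Calculus.ContDiff.Bounds
import Mathlib.Analysis.Calculus.ContDiff.Operations
import Mathlib.Topology.Algebra.Order.Group
import HarnessLib

/-!
# Bounded jets: Leibniz on a piece, affine change of variables, reflections along a transversal ray

Analysis/Calculus support file (everything PROVED; no definition, no named fact, no `sorry`).  The bookkeeping behind Harish-Chandra's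
and Bouaziz's property (I₁) «toutes les dérivées sont bornées sur `K ∩ H_reg`» when the family is MULTIPLIED by a smooth normaliser,
SUMMED, or read through an AFFINE change of coordinates (A. Bouaziz, *Intégrales orbitales sur les groupes de Lie réductifs*, Ann. Sci.
ÉNS 27 (1994), §3.2 (I₁) p. 579), and the chain rule behind the mirror symmetry of one-sided jets across a wall (D. Shelstad,
*Characters and inner forms of a quasi-split group over `ℝ`*, Compositio Math. 39 (1979), §4, property (II) p. 23 and the proof of
Thm. 4.7 p. 31: the two one-sided jumps of a reflected pair differ by the sign `(−1)^{number of normal derivatives}`).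

§1 BOUNDED JETS.  `bddAbove_norm_iteratedFDeriv_mul` — on a subset `A` of an open set `O` where `φ`, `f` are `C^∞`, bounds for the jets of
orders `≤ n` of `φ` and of `f` on `A` give a bound for the `n`-th jet of `φ·f` on `A` (Mathlib's Leibniz estimate
`norm_iteratedFDerivWithin_mul_le` on `O`); `…_mul_inter_of_isCompact` — the (I₁) shape `A = K ∩ O`, `K` compact inside an open set where
`φ` is smooth (its jets are bounded on `K` for free); `bddAbove_norm_iteratedFDeriv_add` (sums); `bddAbove_norm_iteratedFDeriv_comp_affine`
(through `y ↦ A y + b`, `A` a continuous linear automorphism: bound `× ‖A‖ⁿ`).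
§2 JETS THROUGH AN AFFINE MAP.  `iteratedFDeriv_comp_affine_apply` — `Dⁿ(f ∘ (A· + b))(x)(m) = Dⁿf(Ax + b)(A ∘ m)` with NO
differentiability hypothesis (Mathlib `ContinuousLinearEquiv.iteratedFDerivWithin_comp_right`); `…_of_eigen` — if the directions are
eigenvectors, `A (m i) = ε i • m i`, the value is `(∏ ε i) • Dⁿf(Ax + b)(m)`; `prod_eq_neg_one_pow_card` — for signs `ε i = ±1` the product is
`(−1)^{#{i | ε i = −1}}`.
§3 REFLECTIONS ALONG A TRANSVERSAL RAY.  For a linear involution-type map `A` fixing the wall point `q` and reversing the transversal `v`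
(`A q = q`, `A v = −v`): `iteratedFDeriv_comp_reflection_ray_apply` — `Dⁿ(f ∘ A)(q + t v)(m) = (∏ ε) • Dⁿf(q − t v)(m)`; hence the
ONE-SIDED LIMITS are exchanged and signed: `tendsto_iteratedFDeriv_comp_reflection_ray_nhdsGT∕nhdsLT` (limit of `f`'s jet from `t < 0`
⇒ limit of `(f ∘ A)`'s jet from `t > 0`, times `∏ ε`).  With `GLUE-X-gen` (`SmoothGluingAcrossHyperplaneRay`) this is the mechanism
«the jumps of `f + f ∘ A` along the normal are `(1 − (−1)^ℓ)·jump`» used for the transfer family across a compact wall.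

What is NOT here: no group, no chart, no transfer factor (the dress is F0P3a-p09's `ArchTransfFamilySmoothAcross`).

## References
* A. Bouaziz, *Intégrales orbitales sur les groupes de Lie réductifs*, Ann. Sci. ÉNS (4) 27 (1994), §3.2 (I₁) p. 579.
* D. Shelstad, *Characters and inner forms of a quasi-split group over `ℝ`*, Compositio Math. 39 (1979), §4 pp. 23, 31.
-/

noncomputable section

open Set Filter Function Finset
open scoped Topology ContDiff

namespace Literature.Analysis.Calculus

variable {E : Type*} [NormedAddCommGroup E] [NormedSpace ℝ E]
  {F : Type*} [NormedAddCommGroup F] [NormedSpace ℝ F]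

/-! ### §1 Bounded jets: Leibniz, sums, affine changes of variables -/

section Bounded

variable {𝔸 : Type*} [NormedRing 𝔸] [NormedAlgebra ℝ 𝔸]

/-- **LEIBNIZ FOR BOUNDED JETS ON A PIECE.**  On `A ⊆ O` (`O` open, `φ`, `f` `C^∞` on `O`), bounds for the jets of orders `≤ n` of `φ` and
of `f` on `A` bound the `n`-th jet of `φ · f` on `A`. [cite: Bouaziz1994IntegralesOrbitales, §3.2 (I₁) p. 579] -/
theorem bddAbove_norm_iteratedFDeriv_mul {O A : Set E} (hO : IsOpen O) (hAO : A ⊆ O) {φ f : E → 𝔸}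
    (hφ : ContDiffOn ℝ ∞ φ O) (hf : ContDiffOn ℝ ∞ f O) {n : ℕ}
    (hbφ : ∀ i ≤ n, BddAbove ((fun y => ‖iteratedFDeriv ℝ i φ y‖) '' A))
    (hbf : ∀ i ≤ n, BddAbove ((fun y => ‖iteratedFDeriv ℝ i f y‖) '' A)) :
    BddAbove ((fun y => ‖iteratedFDeriv ℝ n (fun y => φ y * f y) y‖) '' A) := by
  -- uniform constants for the lower-order jets
  choose Cφ hCφ using fun i : Fin (n + 1) => hbφ i (Nat.lt_succ_iff.1 i.2)
  choose Cf hCf using fun i : Fin (n + 1) => hbf i (Nat.lt_succ_iff.1 i.2)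
  refine ⟨∑ i ∈ Finset.range (n + 1), (n.choose i : ℝ) * |Cφ ⟨min i n, by omega⟩| * |Cf ⟨n - i, by omega⟩|, ?_⟩
  rintro _ ⟨y, hy, rfl⟩
  have hyO : y ∈ O := hAO hy
  have h1 := norm_iteratedFDerivWithin_mul_le (𝕜 := ℝ) hφ hf hO.uniqueDiffOn hyO (n := n) (by exact_mod_cast le_top)
  rw [iteratedFDerivWithin_of_isOpen n hO hyO] at h1
  refine h1.trans (Finset.sum_le_sum fun i hi => ?_)
  have hin : i ≤ n := Nat.lt_succ_iff.1 (Finset.mem_range.1 hi)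
  rw [iteratedFDerivWithin_of_isOpen i hO hyO, iteratedFDerivWithin_of_isOpen (n - i) hO hyO]
  have e1 : ‖iteratedFDeriv ℝ i φ y‖ ≤ |Cφ ⟨min i n, by omega⟩| := by
    have : (⟨min i n, by omega⟩ : Fin (n + 1)) = ⟨i, by omega⟩ := by ext; simp [hin]
    rw [this]
    exact (mem_upperBounds.1 (hCφ ⟨i, by omega⟩) _ ⟨y, hy, rfl⟩).trans (le_abs_self _)
  have e2 : ‖iteratedFDeriv ℝ (n - i) f y‖ ≤ |Cf ⟨n - i, by omega⟩| :=
    (mem_upperBounds.1 (hCf ⟨n - i, by omega⟩) _ ⟨y, hy, rfl⟩).trans (le_abs_self _)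
  have h0 : (0 : ℝ) ≤ (n.choose i : ℝ) := by positivity
  calc (n.choose i : ℝ) * ‖iteratedFDeriv ℝ i φ y‖ * ‖iteratedFDeriv ℝ (n - i) f y‖
      ≤ (n.choose i : ℝ) * |Cφ ⟨min i n, by omega⟩| * |Cf ⟨n - i, by omega⟩| := by
        gcongr

omit [NormedSpace ℝ F] in
/-- The jets of a function `C^∞` on an open set are bounded on each compact subset (continuity). [cite: Bouaziz1994IntegralesOrbitales, §3.2 (I₁) p. 579] -/
theorem bddAbove_norm_iteratedFDeriv_of_isCompact [NormedSpace ℝ F] {V K : Set E} (hV : IsOpen V) (hK : IsCompact K) (hKV : K ⊆ V)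
    {g : E → F} (hg : ContDiffOn ℝ ∞ g V) (i : ℕ) :
    BddAbove ((fun y => ‖iteratedFDeriv ℝ i g y‖) '' K) := by
  have hc : ContinuousOn (iteratedFDeriv ℝ i g) V :=
    (hg.continuousOn_iteratedFDerivWithin (m := i) (by exact_mod_cast le_top) hV.uniqueDiffOn).congr
      fun z hz => (iteratedFDerivWithin_of_isOpen i hV hz).symm
  exact (hK.image_of_continuousOn ((continuous_norm.comp_continuousOn hc).mono hKV)).bddAbove

/-- **LEIBNIZ FOR BOUNDED JETS, (I₁) SHAPE.**  `K` compact inside an open `V` where `φ` is `C^∞`, `f` `C^∞` on the open `O` with jets of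
orders `≤ n` bounded on `K ∩ O`: the `n`-th jet of `φ · f` is bounded on `K ∩ O`. [cite: Bouaziz1994IntegralesOrbitales, §3.2 (I₁) p. 579] -/
theorem bddAbove_norm_iteratedFDeriv_mul_inter_of_isCompact {O V K : Set E} (hO : IsOpen O) (hV : IsOpen V) (hK : IsCompact K)
    (hKV : K ⊆ V) {φ f : E → 𝔸} (hφ : ContDiffOn ℝ ∞ φ V) (hf : ContDiffOn ℝ ∞ f O) {n : ℕ}
    (hbf : ∀ i ≤ n, BddAbove ((fun y => ‖iteratedFDeriv ℝ i f y‖) '' (K ∩ O))) :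
    BddAbove ((fun y => ‖iteratedFDeriv ℝ n (fun y => φ y * f y) y‖) '' (K ∩ O)) := by
  refine bddAbove_norm_iteratedFDeriv_mul (hO.inter hV) (fun y hy => ⟨hy.2, hKV hy.1⟩) (hφ.mono inter_subset_right)
    (hf.mono inter_subset_left) (fun i _ => ?_) hbf
  exact (bddAbove_norm_iteratedFDeriv_of_isCompact hV hK hKV hφ i).mono (image_mono inter_subset_left)

omit [NormedSpace ℝ F] in
/-- **BOUNDED JETS OF A SUM.** [cite: Bouaziz1994IntegralesOrbitales, §3.2 (I₁) p. 579] -/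
theorem bddAbove_norm_iteratedFDeriv_add [NormedSpace ℝ F] {O A : Set E} (hO : IsOpen O) (hAO : A ⊆ O) {f g : E → F}
    (hf : ContDiffOn ℝ ∞ f O) (hg : ContDiffOn ℝ ∞ g O) {n : ℕ}
    (hbf : BddAbove ((fun y => ‖iteratedFDeriv ℝ n f y‖) '' A)) (hbg : BddAbove ((fun y => ‖iteratedFDeriv ℝ n g y‖) '' A)) :
    BddAbove ((fun y => ‖iteratedFDeriv ℝ n (f + g) y‖) '' A) := by
  obtain ⟨Cf, hCf⟩ := hbf
  obtain ⟨Cg, hCg⟩ := hbg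
  refine ⟨Cf + Cg, ?_⟩
  rintro _ ⟨y, hy, rfl⟩
  dsimp only
  have hyO : y ∈ O := hAO hy
  have hfa : ContDiffAt ℝ n f y := ((hf y hyO).contDiffAt (hO.mem_nhds hyO)).of_le (by exact_mod_cast le_top)
  have hga : ContDiffAt ℝ n g y := ((hg y hyO).contDiffAt (hO.mem_nhds hyO)).of_le (by exact_mod_cast le_top)
  rw [iteratedFDeriv_add_apply hfa hga]
  exact (norm_add_le _ _).trans (add_le_add (mem_upperBounds.1 hCf _ ⟨y, hy, rfl⟩) (mem_upperBounds.1 hCg _ ⟨y, hy, rfl⟩))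

/-- **LEIBNIZ FOR BOUNDED JETS, WALL SHAPE** (the `hb` hypothesis of ★ `contDiffOn_extendFrom_of_oneSidedLimits_eq` is stable under a
multiplier `φ` smooth ACROSS the wall): `f` `C^∞` off the wall `{ℓ = a}` in `U` with every jet bounded near each wall point, `φ` `C^∞` on `U`
⇒ the same for `φ · f`.  (No compactness: the jets of `φ` are continuous at the wall point, hence bounded near it.)
[cite: Bouaziz1994IntegralesOrbitales, §3.2 (I₁) p. 579] -/
theorem wallBound_norm_iteratedFDeriv_mul (ℓ : E →L[ℝ] ℝ) (a : ℝ) {U : Set E} (hU : IsOpen U) {φ f : E → 𝔸}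
    (hφ : ContDiffOn ℝ ∞ φ U) (hf : ContDiffOn ℝ ∞ f (U ∩ {y | ℓ y ≠ a}))
    (hb : ∀ x ∈ U, ℓ x = a → ∀ n : ℕ, ∃ C : ℝ, ∀ᶠ y in 𝓝 x, ℓ y ≠ a → ‖iteratedFDeriv ℝ n f y‖ ≤ C) :
    ∀ x ∈ U, ℓ x = a → ∀ n : ℕ, ∃ C : ℝ, ∀ᶠ y in 𝓝 x, ℓ y ≠ a → ‖iteratedFDeriv ℝ n (fun y => φ y * f y) y‖ ≤ C := by
  intro x hxU hxa n
  have hO : IsOpen (U ∩ {y | ℓ y ≠ a}) := hU.inter (isOpen_ne_fun ℓ.continuous continuous_const)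
  -- bounds for the jets of `f` of orders `≤ n` near `x`, off the wall
  choose Cf hCf using fun i : Fin (n + 1) => hb x hxU hxa i
  -- bounds for the jets of `φ` of orders `≤ n` near `x` (continuity on the open set `U`)
  have hcφ : ∀ i : ℕ, ContinuousOn (iteratedFDeriv ℝ i φ) U := fun i =>
    (hφ.continuousOn_iteratedFDerivWithin (m := i) (by exact_mod_cast le_top) hU.uniqueDiffOn).congr
      fun z hz => (iteratedFDerivWithin_of_isOpen i hU hz).symm
  have hφev : ∀ i : Fin (n + 1), ∀ᶠ y in 𝓝 x, ‖iteratedFDeriv ℝ i φ y‖ ≤ ‖iteratedFDeriv ℝ i φ x‖ + 1 := by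
    intro i
    have h1 : Tendsto (iteratedFDeriv ℝ i φ) (𝓝 x) (𝓝 (iteratedFDeriv ℝ i φ x)) :=
      ((hcφ i) x hxU).continuousAt (hU.mem_nhds hxU)
    have h2 : ∀ᶠ y in 𝓝 x, dist (iteratedFDeriv ℝ i φ y) (iteratedFDeriv ℝ i φ x) < 1 :=
      (Metric.tendsto_nhds.1 h1) 1 one_pos
    filter_upwards [h2] with y hy
    calc ‖iteratedFDeriv ℝ (↑i) φ y‖ ≤ ‖iteratedFDeriv ℝ (↑i) φ x‖ + ‖iteratedFDeriv ℝ (↑i) φ y - iteratedFDeriv ℝ (↑i) φ x‖ :=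
          norm_le_insert' _ _
      _ ≤ ‖iteratedFDeriv ℝ (↑i) φ x‖ + 1 := by rw [← dist_eq_norm]; exact add_le_add le_rfl hy.le
  have hev : ∀ᶠ y in 𝓝 x, y ∈ U ∧ (∀ i : Fin (n + 1), ℓ y ≠ a → ‖iteratedFDeriv ℝ i f y‖ ≤ Cf i) ∧
      ∀ i : Fin (n + 1), ‖iteratedFDeriv ℝ i φ y‖ ≤ ‖iteratedFDeriv ℝ i φ x‖ + 1 :=
    (hU.eventually_mem hxU).and ((eventually_all.2 hCf).and (eventually_all.2 hφev))
  obtain ⟨r, hr, hB⟩ := Metric.eventually_nhds_iff_ball.1 hev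
  -- Leibniz on the piece `ball x r ∩ {ℓ ≠ a}`
  have hsub : Metric.ball x r ∩ {y | ℓ y ≠ a} ⊆ U ∩ {y | ℓ y ≠ a} := fun y hy => ⟨(hB y hy.1).1, hy.2⟩
  have key := bddAbove_norm_iteratedFDeriv_mul (n := n) hO hsub (hφ.mono inter_subset_left) hf
    (fun i hi => ⟨‖iteratedFDeriv ℝ i φ x‖ + 1, by
      rintro _ ⟨y, hy, rfl⟩; exact (hB y hy.1).2.2 ⟨i, Nat.lt_succ_of_le hi⟩⟩)
    (fun i hi => ⟨Cf ⟨i, Nat.lt_succ_of_le hi⟩, by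
      rintro _ ⟨y, hy, rfl⟩; exact (hB y hy.1).2.1 ⟨i, Nat.lt_succ_of_le hi⟩ hy.2⟩)
  obtain ⟨C, hC⟩ := key
  refine ⟨C, ?_⟩
  filter_upwards [Metric.ball_mem_nhds x hr] with y hy hya
  exact mem_upperBounds.1 hC _ ⟨y, ⟨hy, hya⟩, rfl⟩

end Bounded

/-! ### §2 Jets through an affine change of variables -/

section Affine

/-- **JETS THROUGH AN AFFINE MAP** (no differentiability hypothesis): for a continuous linear automorphism `A` and a translation `b`,
`Dⁿ(f ∘ (A· + b))(x)(m) = Dⁿf(A x + b)(A ∘ m)`. [cite: Shelstad1979, §4 property (II) p. 23] -/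
theorem iteratedFDeriv_comp_affine_apply (A : E ≃L[ℝ] E) (b : E) (f : E → F) (x : E) (n : ℕ) (m : Fin n → E) :
    iteratedFDeriv ℝ n (fun y => f (A y + b)) x m = iteratedFDeriv ℝ n f (A x + b) fun i => A (m i) := by
  have h1 : (fun y => f (A y + b)) = (fun z => f (z + b)) ∘ A := rfl
  have h2 := A.iteratedFDerivWithin_comp_right (fun z => f (z + b)) uniqueDiffOn_univ (mem_univ (A x)) n
  simp only [preimage_univ, iteratedFDerivWithin_univ] at h2
  rw [h1, h2, ContinuousMultilinearMap.compContinuousLinearMap_apply, iteratedFDeriv_comp_add_right]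
  rfl

/-- **JETS THROUGH AN AFFINE MAP ON EIGEN-DIRECTIONS**: if `A (m i) = ε i • m i` for every letter then
`Dⁿ(f ∘ (A· + b))(x)(m) = (∏ i, ε i) • Dⁿf(A x + b)(m)`. [cite: Shelstad1979, §4 property (II) p. 23] -/
theorem iteratedFDeriv_comp_affine_apply_of_eigen (A : E ≃L[ℝ] E) (b : E) (f : E → F) (x : E) (n : ℕ) {m : Fin n → E}
    {ε : Fin n → ℝ} (hm : ∀ i, A (m i) = ε i • m i) :
    iteratedFDeriv ℝ n (fun y => f (A y + b)) x m = (∏ i, ε i) • iteratedFDeriv ℝ n f (A x + b) m := by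
  rw [iteratedFDeriv_comp_affine_apply]
  have : (fun i => A (m i)) = fun i => ε i • m i := funext hm
  rw [this, ContinuousMultilinearMap.map_smul_univ]

/-- **BOUNDED JETS THROUGH AN AFFINE MAP**: a bound for `Dⁿf` on the image `(A· + b) '' T` gives a bound (`× ‖A‖ⁿ`) for `Dⁿ(f ∘ (A· + b))` on `T`.
[cite: Bouaziz1994IntegralesOrbitales, §3.2 (I₁) p. 579] -/
theorem bddAbove_norm_iteratedFDeriv_comp_affine (A : E ≃L[ℝ] E) (b : E) {f : E → F} {T : Set E} {n : ℕ}
    (hb : BddAbove ((fun y => ‖iteratedFDeriv ℝ n f y‖) '' ((fun y => A y + b) '' T))) :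
    BddAbove ((fun y => ‖iteratedFDeriv ℝ n (fun y => f (A y + b)) y‖) '' T) := by
  obtain ⟨C, hC⟩ := hb
  refine ⟨C * ∏ _i : Fin n, ‖(A : E →L[ℝ] E)‖, ?_⟩
  rintro _ ⟨y, hy, rfl⟩
  dsimp only
  have h1 : (fun y => f (A y + b)) = (fun z => f (z + b)) ∘ A := rfl
  have h2 := A.iteratedFDerivWithin_comp_right (fun z => f (z + b)) uniqueDiffOn_univ (mem_univ (A y)) n
  simp only [preimage_univ, iteratedFDerivWithin_univ] at h2
  rw [h1, h2, iteratedFDeriv_comp_add_right]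
  refine (ContinuousMultilinearMap.norm_compContinuousLinearMap_le _ _).trans ?_
  have hCy : ‖iteratedFDeriv ℝ n f (A y + b)‖ ≤ C := mem_upperBounds.1 hC _ ⟨A y + b, ⟨y, hy, rfl⟩, rfl⟩
  have hp : (0 : ℝ) ≤ ∏ _i : Fin n, ‖(A : E →L[ℝ] E)‖ := Finset.prod_nonneg fun _ _ => norm_nonneg _
  exact mul_le_mul_of_nonneg_right hCy hp

/-- For signs `ε i ∈ {1, −1}` the product is `(−1)^{#{i | ε i = −1}}`. [cite: Shelstad1979, Thm. 4.7 proof p. 31] -/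
theorem prod_eq_neg_one_pow_card {n : ℕ} {ε : Fin n → ℝ} (hε : ∀ i, ε i = 1 ∨ ε i = -1) :
    ∏ i, ε i = (-1) ^ (Finset.univ.filter fun i => ε i = -1).card := by
  classical
  rw [← Finset.prod_filter_mul_prod_filter_not Finset.univ (fun i => ε i = -1)]
  have h1 : ∏ i ∈ Finset.univ.filter (fun i => ε i = -1), ε i = (-1) ^ (Finset.univ.filter fun i => ε i = -1).card := by
    rw [Finset.prod_congr rfl (fun i hi => (Finset.mem_filter.1 hi).2), Finset.prod_const]
  have h2 : ∏ i ∈ Finset.univ.filter (fun i => ¬ε i = -1), ε i = 1 :=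
    Finset.prod_eq_one fun i hi => ((hε i).resolve_right (Finset.mem_filter.1 hi).2)
  rw [h1, h2, mul_one]

/-- **JETS THROUGH A LINEAR AUTOMORPHISM** (`b = 0`): `Dⁿ(f ∘ A)(x)(m) = Dⁿf(A x)(A ∘ m)`, no differentiability hypothesis.
[cite: Shelstad1979, §4 property (II) p. 23] -/
theorem iteratedFDeriv_comp_continuousLinearEquiv_apply (A : E ≃L[ℝ] E) (f : E → F) (x : E) (n : ℕ) (m : Fin n → E) :
    iteratedFDeriv ℝ n (f ∘ A) x m = iteratedFDeriv ℝ n f (A x) (A ∘ m) := by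
  have h1 : (f ∘ A) = fun y => f (A y + 0) := by ext y; simp
  rw [h1, iteratedFDeriv_comp_affine_apply, add_zero]
  rfl

/-- **JETS THROUGH A LINEAR AUTOMORPHISM ON EIGEN-DIRECTIONS**: `A (m i) = ε i • m i` ⇒ `Dⁿ(f ∘ A)(x)(m) = (∏ ε) • Dⁿf(A x)(m)`.
[cite: Shelstad1979, §4 property (II) p. 23] -/
theorem iteratedFDeriv_comp_continuousLinearEquiv_apply_of_eigen (A : E ≃L[ℝ] E) (f : E → F) (x : E) (n : ℕ) {m : Fin n → E}
    {ε : Fin n → ℝ} (hm : ∀ i, A (m i) = ε i • m i) :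
    iteratedFDeriv ℝ n (f ∘ A) x m = (∏ i, ε i) • iteratedFDeriv ℝ n f (A x) m := by
  have h1 : (f ∘ A) = fun y => f (A y + 0) := by ext y; simp
  rw [h1, iteratedFDeriv_comp_affine_apply_of_eigen A 0 f x n hm, add_zero]

/-- **THE EVENNESS KILLER**: if `f` is invariant under `R` (`f ∘ R = f`), `R` fixes `x`, and the word `m` consists of eigen-directions with
`∏ ε = −1` (an ODD number of reversed letters), then `Dⁿf(x)(m) = 0`. [cite: Shelstad1979, Thm. 4.7 proof p. 31] -/
theorem iteratedFDeriv_apply_eq_zero_of_comp_eq_self (R : E ≃L[ℝ] E) {f : E → F} (hf : f ∘ R = f) {x : E} (hx : R x = x) (n : ℕ)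
    {m : Fin n → E} {ε : Fin n → ℝ} (hm : ∀ i, R (m i) = ε i • m i) (hε : ∏ i, ε i = -1) :
    iteratedFDeriv ℝ n f x m = 0 := by
  have h1 := iteratedFDeriv_comp_continuousLinearEquiv_apply_of_eigen R f x n hm
  rw [hf, hx, hε, neg_one_smul] at h1
  have h2 : (2 : ℝ) • iteratedFDeriv ℝ n f x m = 0 := by rw [two_smul]; nth_rewrite 2 [h1]; exact add_neg_cancel _
  exact (smul_eq_zero.1 h2).resolve_left two_ne_zero

end Affine

/-! ### §3 Reflections along a transversal ray: the one-sided jets are exchanged and signed -/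

section Reflection

/-- **JETS OF A REFLECTED FUNCTION ALONG THE NORMAL RAY**: `A q = q`, `A v = −v`, eigen-directions `A (m i) = ε i • m i` ⇒
`Dⁿ(f ∘ A)(q + t v)(m) = (∏ ε) • Dⁿf(q + (−t) v)(m)`. [cite: Shelstad1979, §4 property (II) p. 23] -/
theorem iteratedFDeriv_comp_reflection_ray_apply (A : E ≃L[ℝ] E) {q v : E} (hq : A q = q) (hv : A v = -v) (f : E → F)
    (n : ℕ) {m : Fin n → E} {ε : Fin n → ℝ} (hm : ∀ i, A (m i) = ε i • m i) (t : ℝ) :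
    iteratedFDeriv ℝ n (f ∘ A) (q + t • v) m = (∏ i, ε i) • iteratedFDeriv ℝ n f (q + (-t) • v) m := by
  have h1 : (f ∘ A) = fun y => f (A y + 0) := by ext y; simp
  rw [h1, iteratedFDeriv_comp_affine_apply_of_eigen A 0 f (q + t • v) n hm]
  congr 2
  simp [hq, hv, neg_smul, smul_neg]

/-- **ONE-SIDED JETS OF A REFLECTED FUNCTION, `t → 0⁺` from `t → 0⁻`**: the limit of `f`'s jet from the side `t < 0` is, up to the sign
`∏ ε`, the limit of `(f ∘ A)`'s jet from the side `t > 0`. [cite: Shelstad1979, Thm. 4.7 proof p. 31] -/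
theorem tendsto_iteratedFDeriv_comp_reflection_ray_nhdsGT (A : E ≃L[ℝ] E) {q v : E} (hq : A q = q) (hv : A v = -v) (f : E → F)
    (n : ℕ) {m : Fin n → E} {ε : Fin n → ℝ} (hm : ∀ i, A (m i) = ε i • m i) {l : F}
    (h : Tendsto (fun t : ℝ => iteratedFDeriv ℝ n f (q + t • v) m) (𝓝[<] 0) (𝓝 l)) :
    Tendsto (fun t : ℝ => iteratedFDeriv ℝ n (f ∘ A) (q + t • v) m) (𝓝[>] 0) (𝓝 ((∏ i, ε i) • l)) := by
  have h1 : Tendsto Neg.neg (𝓝[>] (0 : ℝ)) (𝓝[<] (0 : ℝ)) := by simpa using tendsto_neg_nhdsGT (a := (0 : ℝ))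
  have h2 : Tendsto (fun t : ℝ => iteratedFDeriv ℝ n f (q + (-t) • v) m) (𝓝[>] 0) (𝓝 l) := h.comp h1
  have h3 := h2.const_smul (∏ i, ε i)
  refine h3.congr' (Eventually.of_forall fun t => ?_)
  exact (iteratedFDeriv_comp_reflection_ray_apply A hq hv f n hm t).symm

/-- **ONE-SIDED JETS OF A REFLECTED FUNCTION, `t → 0⁻` from `t → 0⁺`.** [cite: Shelstad1979, Thm. 4.7 proof p. 31] -/
theorem tendsto_iteratedFDeriv_comp_reflection_ray_nhdsLT (A : E ≃L[ℝ] E) {q v : E} (hq : A q = q) (hv : A v = -v) (f : E → F)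
    (n : ℕ) {m : Fin n → E} {ε : Fin n → ℝ} (hm : ∀ i, A (m i) = ε i • m i) {l : F}
    (h : Tendsto (fun t : ℝ => iteratedFDeriv ℝ n f (q + t • v) m) (𝓝[>] 0) (𝓝 l)) :
    Tendsto (fun t : ℝ => iteratedFDeriv ℝ n (f ∘ A) (q + t • v) m) (𝓝[<] 0) (𝓝 ((∏ i, ε i) • l)) := by
  have h1 : Tendsto Neg.neg (𝓝[<] (0 : ℝ)) (𝓝[>] (0 : ℝ)) := by simpa using tendsto_neg_nhdsLT (a := (0 : ℝ))
  have h2 : Tendsto (fun t : ℝ => iteratedFDeriv ℝ n f (q + (-t) • v) m) (𝓝[<] 0) (𝓝 l) := h.comp h1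
  have h3 := h2.const_smul (∏ i, ε i)
  refine h3.congr' (Eventually.of_forall fun t => ?_)
  exact (iteratedFDeriv_comp_reflection_ray_apply A hq hv f n hm t).symm

/-- **THE SYMMETRISED PAIR `f + f ∘ A` HAS NO JUMP ON EVEN WORDS AND THE DOUBLED JUMP OTHERWISE** — limit form: if `f`'s jet on the word
`m` tends to `lp` from `t > 0` and to `lm` from `t < 0`, then `(f + f ∘ A)`'s jet tends to `lp + (∏ ε) • lm` from `t > 0` and to
`lm + (∏ ε) • lp` from `t < 0`. [cite: Shelstad1979, Thm. 4.7 proof p. 31] -/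
theorem tendsto_iteratedFDeriv_add_comp_reflection_ray (A : E ≃L[ℝ] E) {q v : E} (hq : A q = q) (hv : A v = -v) {f : E → F}
    {O : Set E} (hO : IsOpen O) (hf : ContDiffOn ℝ ∞ f O) (hfA : ContDiffOn ℝ ∞ (f ∘ A) O)
    (hray : ∀ᶠ t : ℝ in 𝓝[≠] 0, q + t • v ∈ O)
    (n : ℕ) {m : Fin n → E} {ε : Fin n → ℝ} (hm : ∀ i, A (m i) = ε i • m i) {lp lm : F}
    (hp : Tendsto (fun t : ℝ => iteratedFDeriv ℝ n f (q + t • v) m) (𝓝[>] 0) (𝓝 lp))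
    (hm' : Tendsto (fun t : ℝ => iteratedFDeriv ℝ n f (q + t • v) m) (𝓝[<] 0) (𝓝 lm)) :
    Tendsto (fun t : ℝ => iteratedFDeriv ℝ n (f + f ∘ A) (q + t • v) m) (𝓝[>] 0) (𝓝 (lp + (∏ i, ε i) • lm)) ∧
    Tendsto (fun t : ℝ => iteratedFDeriv ℝ n (f + f ∘ A) (q + t • v) m) (𝓝[<] 0) (𝓝 (lm + (∏ i, ε i) • lp)) := by
  have hsum : ∀ t : ℝ, q + t • v ∈ O →
      iteratedFDeriv ℝ n (f + f ∘ A) (q + t • v) m = iteratedFDeriv ℝ n f (q + t • v) m + iteratedFDeriv ℝ n (f ∘ A) (q + t • v) m := by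
    intro t ht
    have hfa : ContDiffAt ℝ n f (q + t • v) := ((hf _ ht).contDiffAt (hO.mem_nhds ht)).of_le (by exact_mod_cast le_top)
    have hga : ContDiffAt ℝ n (f ∘ A) (q + t • v) := ((hfA _ ht).contDiffAt (hO.mem_nhds ht)).of_le (by exact_mod_cast le_top)
    rw [iteratedFDeriv_add_apply hfa hga]; rfl
  have hrayp : ∀ᶠ t : ℝ in 𝓝[>] 0, q + t • v ∈ O := hray.filter_mono (nhdsWithin_mono _ fun t (ht : 0 < t) => ne_of_gt ht)
  have hraym : ∀ᶠ t : ℝ in 𝓝[<] 0, q + t • v ∈ O := hray.filter_mono (nhdsWithin_mono _ fun t (ht : t < 0) => ne_of_lt ht)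
  constructor
  · have h1 := hp.add (tendsto_iteratedFDeriv_comp_reflection_ray_nhdsGT A hq hv f n hm hm')
    exact h1.congr' (hrayp.mono fun t ht => (hsum t ht).symm)
  · have h1 := hm'.add (tendsto_iteratedFDeriv_comp_reflection_ray_nhdsLT A hq hv f n hm hp)
    exact h1.congr' (hraym.mono fun t ht => (hsum t ht).symm)

end Reflection

end Literature.Analysis.Calculus
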